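import Mathlib
import Summits.PneNP.PneNP.Theses.OverlapGapAlgebra
import Summits.PneNP.PneNP.Theorems.OverlapGapAlgebraCruxesImplyTarget
import Summits.PneNP.PneNP.Theorems.OverlapGapAlgebraPositiveSatProbability
import Summits.PneNP.PneNP.Theorems.OverlapGapAlgebraAssembly
import Summits.PneNP.PneNP.Theorems.OverlapGapAlgebraEvalRelationInP

/-!
# Route OverlapGapAlgebra, crux `SearchHardWindow` (stmt-PneNP-2460): reduction to the two open cruxes

With `PositiveSatProbability` (stmt-PneNP-2464, `positiveSatProbability_proof`), the glue
`CruxesImplyTarget` (stmt-PneNP-2466, `cruxesImplyTarget_proof`), the assembly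
(`overlapGapAlgebra_assembly_proof`) and `EvalRelationInP` (`overlapGap_evalRelationInP`) all proved
in the tree, the crux `SearchHardWindow` — and with it the summit statement `PneNP` — is reduced to
exactly the two open cruxes of the route:

* `NoStableSection` (stmt-PneNP-2462; Bresler–Huang 2021 ensemble multi-OGP read for all maps —
  a theorem of probability, in print), and
* `SolvableImpliesStableSection` (stmt-PneNP-2463; "instability needs algebra", the
  P≠NP-strength transfer).

`searchHardWindow_of_cruxes : NoStableSection → SolvableImpliesStableSection → SearchHardWindow` and
`pneNP_of_cruxes : NoStableSection → SolvableImpliesStableSection → PneNP`. No literature fact is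
assumed; both are one-line compositions of accepted tree theorems, recorded so that the ledger links
the dependency of stmt-PneNP-2460 on stmt-PneNP-2462 ∧ stmt-PneNP-2463 to a kernel-checked term.
-/

namespace Summit.PneNP.PneNP.Theorems

set_option linter.dupNamespace false -- `Summit.PneNP.PneNP.…`: summit = sub-problem (D-0017)

open Summit.PneNP.PneNP.Theses.OverlapGapAlgebra

/-- **Crux `SearchHardWindow` (stmt-PneNP-2460) modulo the two open cruxes.** If Bresler–Huang's
no-stable-section bound holds for all maps (`NoStableSection`, stmt-PneNP-2462) and every
polynomial-time solver of random `k`-SAT forces a stable section (`SolvableImpliesStableSection`,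
stmt-PneNP-2463), then random `k`-SAT search at density `5·2^k log k/k` (some `k`) is satisfiable
with uniformly positive probability yet solved by every polynomial-time `f` with probability `→ 0`.
The third hypothesis of the glue, `PositiveSatProbability`, is the proved tree theorem
`positiveSatProbability_proof` (Achlioptas–Peres 2004). -/
theorem searchHardWindow_of_cruxes (hNo : NoStableSection) (hSolv : SolvableImpliesStableSection) :
    SearchHardWindow :=
  cruxesImplyTarget_proof hNo hSolv positiveSatProbability_proof

/-- **The whole route modulo its two open cruxes**: `NoStableSection` and
`SolvableImpliesStableSection` imply the summit statement `PneNP`, through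
`searchHardWindow_of_cruxes`, the proved plumbing item `EvalRelationInP`
(`overlapGap_evalRelationInP`) and the proved assembly `overlapGapAlgebra_assembly_proof`
(search-to-decision, Arora–Barak Thm. 2.18). -/
theorem pneNP_of_cruxes (hNo : NoStableSection) (hSolv : SolvableImpliesStableSection) :
    _root_.PneNP :=
  overlapGapAlgebra_assembly_proof overlapGap_evalRelationInP (searchHardWindow_of_cruxes hNo hSolv)

open Filter in
/-- **The minimal transfer the crux needs.** `SearchHardWindow` already follows from
`NoStableSection` together with the transfer "polynomial-time solvable ⇒ stably sectionable" asked
ONLY at the window density `α_k = 5·2^k log k/k` and only for all sufficiently large `k` (threshold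
form `∃ k₁ ∀ k ≥ k₁`), instead of the filed crux `SolvableImpliesStableSection`, which demands it for
every `k ≥ 3` and every density `α > 0`. (So a refutation of the filed transfer at small `k` or away
from the window would not touch this derivation of the crux.) Proof: the glue of `CruxesImplyTarget`
re-run at `k := max (max k₀ k₁) (max k₂ 3)`, with `PositiveSatProbability` discharged by
`positiveSatProbability_proof`. -/
theorem searchHardWindow_of_windowTransfer (hNo : NoStableSection)
    (hT : ∃ k₁ : ℕ, ∀ k : ℕ, k₁ ≤ k → ∀ η ν : ℝ, 0 < η → 0 < ν →
      (∃ f : List Bool → List Bool, Literature.Computability.Complexity.IsPolyTime f ∧ ∃ ε : ℝ, 0 < ε ∧ ∃ᶠ n : ℕ in Filter.atTop, ∀ m : ℕ, m = ⌊5 * 2 ^ k * Real.log k / k * n⌋₊ → ε ≤ ((Finset.univ.filter fun Φ : Fin m → Fin k → Fin n × Bool => ∀ i, ∃ j, (f (Literature.Computability.Complexity.encodingCNF.encode (List.ofFn fun a => List.ofFn fun b => (((Φ a b).1 : ℕ), (Φ a b).2)))).getD (Φ i j).1 false = (Φ i j).2).card : ℝ) / Fintype.card (Fin m → Fin k → Fin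 n × Bool)) →
      ∀ c : ℝ, 0 < c → ∃ᶠ n : ℕ in Filter.atTop, ∀ m : ℕ, m = ⌊5 * 2 ^ k * Real.log k / k * n⌋₊ → ∃ g : (Fin m → Fin k → Fin n × Bool) → (Fin n → Bool), Real.exp (-(c * n)) * Fintype.card (Fin (k + 1) → Fin m → Fin k → Fin n × Bool) ≤ ((Finset.univ.filter fun Ψ : Fin (k + 1) → Fin m → Fin k → Fin n × Bool => let P : Fin k → ℕ → Fin m → Fin k → Fin n × Bool := fun r q a b => if (a : ℕ) * k + b < q then Ψ r.succ a b else Ψ r.castSucc a b; (∀ r : Fin k, ∀ q ≤ m * k, ((Finset.univ.filter fun i : Fin m => ∀ j, g (P r q) (P r q i j).1 ≠ (P r q i j).2).card : ℝ) ≤ ν * m) ∧ ∀ r : Fin k, ∀ q < m * k, (hammingDist (g (P r q)) (g (P r (q + 1))) : ℝ) ≤ η * n).card : ℝ)) :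
    SearchHardWindow := by
  unfold SearchHardWindow
  obtain ⟨k₀, hk₀⟩ := hNo
  obtain ⟨k₁, hk₁⟩ := hT
  obtain ⟨k₂, hk₂⟩ := positiveSatProbability_proof
  obtain ⟨k, hk0, hk1, hk2, hk3⟩ : ∃ k : ℕ, k₀ ≤ k ∧ k₁ ≤ k ∧ k₂ ≤ k ∧ 3 ≤ k :=
    ⟨max (max k₀ k₁) (max k₂ 3),
      le_trans (le_max_left _ _) (le_max_left _ _), le_trans (le_max_right _ _) (le_max_left _ _),
      le_trans (le_max_left _ _) (le_max_right _ _), le_trans (le_max_right _ _) (le_max_right _ _)⟩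
  obtain ⟨η, hη, ν, hν, c, hc, hev⟩ := hk₀ k hk0
  obtain ⟨ε, hε, hsat⟩ := hk₂ k hk2
  refine ⟨k, 5 * 2 ^ k * Real.log k / k, ⟨ε, hε, hsat⟩, ?_⟩
  intro f hf ε' hε'
  by_contra hnot
  -- the window transfer, fed with the frequent success of `f` and the rate `c/2`
  have key := hk₁ k hk1 η ν hη hν
    ⟨f, hf, ε', hε', (Filter.not_eventually.1 hnot).mono fun n hn m hm => by
      by_contra hlt
      exact hn fun m' hm' => by subst hm'; subst hm; exact (not_le.1 hlt).le⟩
    (c / 2) (half_pos hc)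
  -- frequently (∃ stable section) ∧ eventually (no stable section) ∧ eventually (n ≥ 1) ⇒ False
  refine Filter.frequently_false (Filter.atTop : Filter ℕ)
    ((key.and_eventually (hev.and (Filter.eventually_ge_atTop 1))).mono ?_)
  rintro n ⟨h₁, h₂, hn1⟩
  obtain ⟨g, hg⟩ := h₁ _ rfl
  have hg' := h₂ _ rfl g
  haveI : NeZero n := ⟨Nat.one_le_iff_ne_zero.1 hn1⟩
  exact overlapGap_exp_sandwich_false hc hn1 hg hg'

end Summit.PneNP.PneNP.Theorems
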